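import Literature.NumberTheory.GaloisRepresentations.CubicReciprocityRationalPrime
import HarnessLib

/-!
# Cubic reciprocity with a split rational prime `q ≡ 1 (mod 3)` (Eisenstein), by Gauss sums:
# `χ_𝔭(q) · χ_𝔮(N𝔭 · J(χ_𝔭, χ_𝔭)) = 1` for `𝔮 ∣ q` of degree one

Topic `Literature/NumberTheory/GaloisRepresentations` (the companion of
`CubicReciprocityRationalPrime.lean`, which treats an INERT rational prime `q ≡ 2 (mod 3)`); namespace
`Literature.NumberTheory.GaloisRepresentations`. Everything here is PROVED (no `sorry`, no definition,
no named fact).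

Source: K. Ireland, M. Rosen, *A Classical Introduction to Modern Number Theory*, Ch. 9 §4, proof of
Theorem 1 (the law of cubic reciprocity), PDF pp. 123–124 of the held copy
(`book:ireland1982-classical-introduction-modern-number-theory`). The printed case "`π₁ = q ≡ 2 (3)`"
raises `g(χ_π)` to the power `q² = N(q)`; the present file runs the SAME argument with a prime `𝔮` of
residue degree one above a rational prime `q ≡ 1 (mod 3)` (so `N𝔮 = q` and one Frobenius suffices):
in characteristic `q`, `g(χ_𝔭)^q = g_q(χ_𝔭) = χ_𝔭(q)⁻¹ g(χ_𝔭)` (Prop. 8.2.1), `g(χ_𝔭)³ = N𝔭 · J(χ_𝔭, χ_𝔭)`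
(Cor. to Prop. 8.3.3), hence `χ_𝔭(q) (N𝔭 · J)^{(q−1)/3} = 1`, and `x^{(q−1)/3} ≡ χ_𝔮(x) (mod 𝔮)`
(Prop. 9.3.3 / the definition of `χ_𝔮`). This is the step of Ireland–Rosen's third case
("`Nπ₁ = p₁ ≠ p₂ = Nπ₂`", p. 124, eq. before "Similarly"): "`g(χ_{γ})^{q} ≡ χ_γ(q)^{-1} g(χ_γ)`…", read at
a prime `𝔮` above `q` instead of modulo the element `π₂`.

* `cubicResidueSymbol_natCast_mul_cubicResidueSymbol_eq_one` — **for `q ≡ 1 (mod 3)` prime, `𝔮 ∋ q`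
  with `N𝔮 = q`, and `𝔭 ∤ 3q`: `χ_𝔭(q) · χ_𝔮(N𝔭 · J(χ_𝔭, χ_𝔭)) = 1`** in `𝓞 K` (both factors are cube
  roots of unity). Unlike the inert case, `χ_𝔮(N𝔭)` is NOT `1` in general (rational integers need not
  be cubes modulo a degree-one prime), so `N𝔭` stays in the statement.

For `K = ℚ(ω)`, `𝔭 = (ϖ)` with `ϖ ≡ 1 (3)` of prime norm `p`, `J(χ_𝔭, χ_𝔭) = −ϖ`
(`cubicJacobiSum_eq_neg_of_span_eq`), this reads `χ_ϖ(q) = χ_𝔮(pϖ)⁻¹` for each of the two primes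
`𝔮, 𝔮̄` above `q`; it is used in `GaussSums/EisensteinCubicGaussSumsSplitPrime` to show that every prime
factor of `b` is a cubic residue modulo `ϖ = a + bω`.

## References

* K. Ireland, M. Rosen, *A Classical Introduction to Modern Number Theory*, GTM 84, Springer 1982,
  Ch. 8 §2 Prop. 8.2.1, §3 Prop. 8.3.3 and Cor.; Ch. 9 §3 Props. 9.3.1–9.3.5 and Theorem 1; §4, proof
  of Theorem 1 (PDF pp. 122–124). [IrelandRosen1982]
* G. Eisenstein, *Beweis des Reciprocitätssatzes für die cubischen Reste…*, J. reine angew. Math. 27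
  (1844), 289–310. [cited through IrelandRosen1982]

## Mathlib / tree search

Tree: `cubicJacobiSum`, `cubicJacobiSum_eq`, `three_not_mem_of_natCast_mem`,
`charP_quotient_of_natCast_mem`, `cubicResidueSymbol_natCast_eq_cubicResidueSymbol_cubicJacobiSum`
(the inert case, whose proof this file follows line by line) (`CubicReciprocityRationalPrime`);
`cubicResidueSymbol_spec`, `cubicResidueSymbol_eq_of_pow_three_eq_one`, `cubicResidueChar`,
`cubicResidueChar_pow_three`, `isPrimitiveRoot_mk_of_three_not_mem`, `three_dvd_residueCard_sub_one`,
`residueCard_sub_one_div_three_ne_zero` (`CubicResidueSymbol`). Mathlib: `gaussSum`, `gaussSum_frob`,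
`gaussSum_mulShift`, `gaussSum_pow_eq_prod_jacobiSum`, `gaussSum_ne_zero_of_nontrivial`,
`AddChar.FiniteField.primitiveChar`, `AddChar.pow_mulShift`, `jacobiSum_ringHomComp`.
-/

noncomputable section

namespace Literature.NumberTheory.GaloisRepresentations

open NumberField IsDedekindDomain

variable {K : Type*} [Field K] [NumberField K]
variable {ζ : 𝓞 K} (hζ : IsPrimitiveRoot ζ 3)

section Reciprocity

variable {q : ℕ} [hq : Fact q.Prime]

include hζ hq in
/-- **Cubic reciprocity with a split rational prime, Jacobi-sum form** (Eisenstein; Ireland–Rosen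
Ch. 9 §4, proof of Thm. 1). Let `K ∋ ζ` (a primitive cube root of unity in `𝓞 K`), `q ≡ 1 (mod 3)` a
rational prime, `𝔮` a finite place of `K` with `q ∈ 𝔮` and `N𝔮 = q`, and `𝔭 ∤ 3q` a finite place.
Then, in `𝓞 K`,
`χ_𝔭(q) · χ_𝔮(N𝔭 · J(χ_𝔭, χ_𝔭)) = 1`.
[cite: IrelandRosen1982, Ch. 9 §4, proof of Theorem 1 (eqs. (1)–(2) with `q² ↦ q = N𝔮`, and the case `Nπ₁ ≠ Nπ₂`, p. 124)] -/
theorem cubicResidueSymbol_natCast_mul_cubicResidueSymbol_eq_one (hq3 : q % 3 = 1)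
    {𝔮 : HeightOneSpectrum (𝓞 K)} (hq𝔮 : (q : 𝓞 K) ∈ 𝔮.asIdeal) (h𝔮 : 𝔮.residueCard = q)
    {𝔭 : HeightOneSpectrum (𝓞 K)} (h3 : (3 : 𝓞 K) ∉ 𝔭.asIdeal) (hq𝔭 : (q : 𝓞 K) ∉ 𝔭.asIdeal) :
    cubicResidueSymbol 𝔭 (q : 𝓞 K ⧸ 𝔭.asIdeal) *
      cubicResidueSymbol 𝔮 (Ideal.Quotient.mk 𝔮.asIdeal ((𝔭.residueCard : 𝓞 K) * cubicJacobiSum hζ 𝔭 h3)) = 1 := by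
  classical
  -- residue fields: `F = 𝓞 K ⧸ 𝔭` (characteristic `p ≠ q`) and `k = 𝓞 K ⧸ 𝔮` (characteristic `q`)
  letI := Ideal.Quotient.field 𝔭.asIdeal
  letI := Fintype.ofFinite (𝓞 K ⧸ 𝔭.asIdeal)
  letI := Ideal.Quotient.field 𝔮.asIdeal
  haveI hchark : CharP (𝓞 K ⧸ 𝔮.asIdeal) q := charP_quotient_of_natCast_mem (K := K) hq𝔮
  have hq3' : Nat.Coprime q 3 := by
    rw [Nat.coprime_comm, Nat.Prime.coprime_iff_not_dvd (by norm_num)]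
    omega
  have h3𝔮 : (3 : 𝓞 K) ∉ 𝔮.asIdeal := three_not_mem_of_natCast_mem hq𝔮 hq3'
  have hcardF : Fintype.card (𝓞 K ⧸ 𝔭.asIdeal) = 𝔭.residueCard := by
    rw [HeightOneSpectrum.residueCard_eq_card_quotient, Nat.card_eq_fintype_card]
  -- the characteristic `p` of `F` is not `q`
  have hpF : ringChar (𝓞 K ⧸ 𝔭.asIdeal) ≠ q := by
    intro h
    haveI : CharP (𝓞 K ⧸ 𝔭.asIdeal) q := h ▸ (inferInstance : CharP (𝓞 K ⧸ 𝔭.asIdeal) (ringChar _))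
    have h0 : ((q : 𝓞 K) : 𝓞 K ⧸ 𝔭.asIdeal) = 0 := by exact_mod_cast CharP.cast_eq_zero (𝓞 K ⧸ 𝔭.asIdeal) q
    exact hq𝔭 ((Ideal.Quotient.eq_zero_iff_mem).mp h0)
  have hringk : ringChar (𝓞 K ⧸ 𝔮.asIdeal) = q := ringChar.eq _ q
  have hchar_ne : ringChar (𝓞 K ⧸ 𝔮.asIdeal) ≠ ringChar (𝓞 K ⧸ 𝔭.asIdeal) := by
    rw [hringk]; exact hpF.symm
  -- a primitive additive character `ψ` of `F` with values in `R = CyclotomicField n k`, char `q`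
  set Ψ := AddChar.FiniteField.primitiveChar (𝓞 K ⧸ 𝔭.asIdeal) (𝓞 K ⧸ 𝔮.asIdeal) hchar_ne with hΨdef
  haveI hcharR : CharP (CyclotomicField Ψ.n (𝓞 K ⧸ 𝔮.asIdeal)) q :=
    charP_of_injective_algebraMap (algebraMap (𝓞 K ⧸ 𝔮.asIdeal) (CyclotomicField Ψ.n (𝓞 K ⧸ 𝔮.asIdeal))).injective q
  set ψ : AddChar (𝓞 K ⧸ 𝔭.asIdeal) (CyclotomicField Ψ.n (𝓞 K ⧸ 𝔮.asIdeal)) := Ψ.char with hψdef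
  have hψ : ψ.IsPrimitive := Ψ.prim
  -- the cubic character, pushed to `R`
  set φ : 𝓞 K →+* CyclotomicField Ψ.n (𝓞 K ⧸ 𝔮.asIdeal) :=
    (algebraMap (𝓞 K ⧸ 𝔮.asIdeal) _).comp (Ideal.Quotient.mk 𝔮.asIdeal) with hφdef
  set χ₀ := cubicResidueChar hζ 𝔭 h3 with hχ₀def
  set χ : MulChar (𝓞 K ⧸ 𝔭.asIdeal) (CyclotomicField Ψ.n (𝓞 K ⧸ 𝔮.asIdeal)) :=
    χ₀.ringHomComp φ with hχdef
  have hχapp : ∀ a : 𝓞 K ⧸ 𝔭.asIdeal, χ a = φ (cubicResidueSymbol 𝔭 a) := fun a ↦ rfl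
  -- `φ` is injective on the cube roots of unity
  have hφζ : IsPrimitiveRoot (φ ζ) 3 :=
    (isPrimitiveRoot_mk_of_three_not_mem hζ h3𝔮).map_of_injective
      (algebraMap (𝓞 K ⧸ 𝔮.asIdeal) (CyclotomicField Ψ.n (𝓞 K ⧸ 𝔮.asIdeal))).injective
  have hφinj : ∀ i j : ℕ, i < 3 → j < 3 → φ (ζ ^ i) = φ (ζ ^ j) → i = j := by
    intro i j hi hj h
    rw [map_pow, map_pow] at h
    exact hφζ.pow_inj hi hj h
  have hroots : ∀ μ : 𝓞 K, μ ^ 3 = 1 → φ μ = 1 → μ = 1 := by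
    intro μ hμ h1
    obtain ⟨i, hi, rfl⟩ := hζ.eq_pow_of_pow_eq_one hμ
    have h0 : φ (ζ ^ i) = φ (ζ ^ 0) := by rw [h1, pow_zero, map_one]
    rw [hφinj i 0 hi (by norm_num) h0, pow_zero]
  -- `χ` is a cubic character of order `3`
  have hχ3 : χ ^ 3 = 1 := by
    rw [hχdef, MulChar.ringHomComp_pow, hχ₀def, cubicResidueChar_pow_three hζ h3, MulChar.ringHomComp_one]
  have hχne : χ ≠ 1 := by
    -- a generator `g` of `Fˣ` has `χ₀ g ≠ 1`
    intro h1
    obtain ⟨g, hg⟩ := IsCyclic.exists_generator (α := (𝓞 K ⧸ 𝔭.asIdeal)ˣ)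
    have hg3 : cubicResidueSymbol 𝔭 (g : 𝓞 K ⧸ 𝔭.asIdeal) ≠ 1 := by
      intro hg1
      have hspec := (cubicResidueSymbol_spec hζ h3 (Units.ne_zero g)).2
      rw [hg1, map_one] at hspec
      -- `g^{(N𝔭-1)/3} = 1` contradicts `orderOf g = N𝔭 - 1`
      have hord : orderOf g = Fintype.card (𝓞 K ⧸ 𝔭.asIdeal) - 1 := by
        rw [orderOf_eq_card_of_forall_mem_zpowers hg, Nat.card_eq_fintype_card, Fintype.card_units]
      have hdvd := orderOf_dvd_of_pow_eq_one (x := g) (n := (𝔭.residueCard - 1) / 3)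
        (Units.ext (by rw [Units.val_pow_eq_pow_val, Units.val_one, ← hspec]))
      rw [hord, hcardF] at hdvd
      have hpos := residueCard_sub_one_div_three_ne_zero hζ h3 (𝔭 := 𝔭)
      have h3dvd := three_dvd_residueCard_sub_one hζ h3 (𝔭 := 𝔭)
      have hle := Nat.le_of_dvd (Nat.pos_of_ne_zero hpos) hdvd
      omega
    apply hg3
    apply hroots _ (cubicResidueSymbol_spec hζ h3 (Units.ne_zero g)).1
    have := congrArg (fun χ' : MulChar (𝓞 K ⧸ 𝔭.asIdeal) (CyclotomicField Ψ.n (𝓞 K ⧸ 𝔮.asIdeal)) ↦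
      χ' (g : 𝓞 K ⧸ 𝔭.asIdeal)) h1
    simpa only [hχapp, MulChar.one_apply_coe] using this
  have hordχ : orderOf χ = 3 := orderOf_eq_prime hχ3 hχne
  -- `χ(-1) = 1`
  have hχneg : χ (-1) = 1 := by
    have h1 : χ (-1) ^ 2 = 1 := by rw [← map_pow, neg_one_sq, map_one]
    have h2 : χ (-1) ^ 3 = 1 := by
      rw [← MulChar.pow_apply' χ three_ne_zero, hχ3, MulChar.one_apply isUnit_one.neg]
    calc χ (-1) = χ (-1) * χ (-1) ^ 2 := by rw [h1, mul_one]
      _ = χ (-1) ^ 3 := by ring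
      _ = 1 := h2
  -- the Gauss sum and its cube
  set g := gaussSum χ ψ with hgdef
  have hcardF0 : (Fintype.card (𝓞 K ⧸ 𝔭.asIdeal) : CyclotomicField Ψ.n (𝓞 K ⧸ 𝔮.asIdeal)) ≠ 0 := by
    intro h0
    obtain ⟨n, hp, hn⟩ := FiniteField.card (𝓞 K ⧸ 𝔭.asIdeal) (ringChar (𝓞 K ⧸ 𝔭.asIdeal))
    rw [hn, Nat.cast_pow, pow_eq_zero_iff (NeZero.ne _)] at h0
    have hdvd : q ∣ ringChar (𝓞 K ⧸ 𝔭.asIdeal) :=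
      (CharP.cast_eq_zero_iff (CyclotomicField Ψ.n (𝓞 K ⧸ 𝔮.asIdeal)) q _).mp h0
    exact hpF ((Nat.prime_dvd_prime_iff_eq hq.out hp).mp hdvd).symm
  have hg0 : g ≠ 0 := gaussSum_ne_zero_of_nontrivial hcardF0 hχne hψ
  have hg3 : g ^ 3 = (𝔭.residueCard : CyclotomicField Ψ.n (𝓞 K ⧸ 𝔮.asIdeal)) *
      φ (cubicJacobiSum hζ 𝔭 h3) := by
    have h := gaussSum_pow_eq_prod_jacobiSum (χ := χ) (ψ := ψ) (by rw [hordχ]; norm_num) hψ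
    rw [hordχ] at h
    rw [hgdef, h, hχneg, one_mul, show (3 - 1 : ℕ) = 2 from rfl, show Finset.Ico 1 2 = {1} from rfl,
      Finset.prod_singleton, pow_one, cubicJacobiSum_eq, hχdef, ← jacobiSum_ringHomComp, hcardF]
  -- Frobenius once: `χ(q) g^{q} = g` (`q ≡ 1 (mod 3)`, so `χ^q = χ`)
  have hqF : IsUnit ((q : 𝓞 K ⧸ 𝔭.asIdeal)) := by
    rw [isUnit_iff_ne_zero]
    intro h0
    have : ((q : 𝓞 K) : 𝓞 K ⧸ 𝔭.asIdeal) = 0 := by exact_mod_cast h0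
    exact hq𝔭 ((Ideal.Quotient.eq_zero_iff_mem).mp this)
  have hfrob : χ (q : 𝓞 K ⧸ 𝔭.asIdeal) * g ^ q = g := by
    have h1 : g ^ q = gaussSum (χ ^ q) (ψ ^ q) := by
      rw [hgdef, gaussSum_frob q χ ψ]
    have h2 : χ ^ q = χ := by
      rw [← pow_mod_orderOf, hordχ, hq3, pow_one]
    have h3' : ψ ^ q = ψ.mulShift (q : 𝓞 K ⧸ 𝔭.asIdeal) := by
      rw [AddChar.pow_mulShift]
    rw [h1, h2, h3', ← hqF.unit_spec, gaussSum_mulShift]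
  -- hence `χ(q) (g³)^{(q-1)/3} = 1`
  have h3q : 3 ∣ q - 1 := by
    have := hq.out.one_le
    omega
  have hq1 : 1 ≤ q := hq.out.one_le
  have hmain : χ (q : 𝓞 K ⧸ 𝔭.asIdeal) * (g ^ 3) ^ ((q - 1) / 3) = 1 := by
    have e : g ^ q = (g ^ 3) ^ ((q - 1) / 3) * g := by
      rw [← pow_mul, Nat.mul_div_cancel' h3q, ← pow_succ, Nat.sub_add_cancel hq1]
    rw [e, ← mul_assoc] at hfrob
    exact mul_right_cancel₀ hg0 (hfrob.trans (one_mul g).symm)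
  -- the right-hand side modulo `𝔮`: `x^{(q-1)/3} ≡ χ_𝔮(x)`
  set J := cubicJacobiSum hζ 𝔭 h3 with hJdef
  set x : 𝓞 K := (𝔭.residueCard : 𝓞 K) * J with hxdef
  have hxφ : (𝔭.residueCard : CyclotomicField Ψ.n (𝓞 K ⧸ 𝔮.asIdeal)) * φ J = φ x := by
    rw [hxdef, map_mul, map_natCast]
  have hx0 : Ideal.Quotient.mk 𝔮.asIdeal x ≠ 0 := by
    intro h0
    have : φ x = 0 := by rw [hφdef, RingHom.comp_apply, h0, map_zero]
    rw [← hxφ, ← hg3] at this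
    exact hg0 (pow_eq_zero_iff (by norm_num) |>.mp this)
  have hexp : (𝔮.residueCard - 1) / 3 = (q - 1) / 3 := by rw [h𝔮]
  obtain ⟨hx3, hxspec⟩ := cubicResidueSymbol_spec hζ h3𝔮 hx0
  rw [hexp] at hxspec
  have hφx : φ (cubicResidueSymbol 𝔮 (Ideal.Quotient.mk 𝔮.asIdeal x)) = (g ^ 3) ^ ((q - 1) / 3) := by
    rw [hg3, hxφ, hφdef, RingHom.comp_apply, hxspec, map_pow, ← RingHom.comp_apply]
  -- assemble: `φ (χ_𝔭(q) χ_𝔮(x)) = 1`, both cube roots of unity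
  have hqF0 : ((q : 𝓞 K ⧸ 𝔭.asIdeal)) ≠ 0 := hqF.ne_zero
  have hprod3 : (cubicResidueSymbol 𝔭 (q : 𝓞 K ⧸ 𝔭.asIdeal) *
      cubicResidueSymbol 𝔮 (Ideal.Quotient.mk 𝔮.asIdeal x)) ^ 3 = 1 := by
    obtain ⟨h1, -⟩ := cubicResidueSymbol_spec hζ h3 hqF0
    rw [mul_pow, h1, hx3, one_mul]
  have hprodφ : φ (cubicResidueSymbol 𝔭 (q : 𝓞 K ⧸ 𝔭.asIdeal) *
      cubicResidueSymbol 𝔮 (Ideal.Quotient.mk 𝔮.asIdeal x)) = 1 := by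
    rw [map_mul, hφx, ← hχapp]
    exact hmain
  exact hroots _ hprod3 hprodφ

include hζ hq in
/-- **The split law solved for `χ_𝔭(q)`**: under the hypotheses of
`cubicResidueSymbol_natCast_mul_cubicResidueSymbol_eq_one`, `χ_𝔭(q) = χ_𝔮(N𝔭 · J(χ_𝔭, χ_𝔭))²` (both factors are cube
roots of unity, so the inverse of `χ_𝔮(N𝔭·J)` is its square) — the form consumed when `χ_𝔭(q)` is to be READ OFF
data at `𝔮` (e.g. for the Größencharakter of `y² = x³ + k`, `EisensteinSexticAuxiliaryPrime`).
[cite: IrelandRosen1982, Ch. 9 §4, proof of Theorem 1 (case `Nπ₁ ≠ Nπ₂`, p. 124)] -/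
theorem cubicResidueSymbol_natCast_eq_sq_of_split (hq3 : q % 3 = 1)
    {𝔮 : HeightOneSpectrum (𝓞 K)} (hq𝔮 : (q : 𝓞 K) ∈ 𝔮.asIdeal) (h𝔮 : 𝔮.residueCard = q)
    {𝔭 : HeightOneSpectrum (𝓞 K)} (h3 : (3 : 𝓞 K) ∉ 𝔭.asIdeal) (hq𝔭 : (q : 𝓞 K) ∉ 𝔭.asIdeal) :
    cubicResidueSymbol 𝔭 (q : 𝓞 K ⧸ 𝔭.asIdeal) =
      cubicResidueSymbol 𝔮 (Ideal.Quotient.mk 𝔮.asIdeal ((𝔭.residueCard : 𝓞 K) * cubicJacobiSum hζ 𝔭 h3)) ^ 2 := by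
  have h := cubicResidueSymbol_natCast_mul_cubicResidueSymbol_eq_one hζ hq3 hq𝔮 h𝔮 h3 hq𝔭
  set x := cubicResidueSymbol 𝔭 (q : 𝓞 K ⧸ 𝔭.asIdeal)
  set y := cubicResidueSymbol 𝔮 (Ideal.Quotient.mk 𝔮.asIdeal ((𝔭.residueCard : 𝓞 K) * cubicJacobiSum hζ 𝔭 h3))
  have hy0 : Ideal.Quotient.mk 𝔮.asIdeal ((𝔭.residueCard : 𝓞 K) * cubicJacobiSum hζ 𝔭 h3) ≠ 0 := by
    intro h0
    have : y = 0 := by rw [show y = cubicResidueSymbol 𝔮 _ from rfl, h0, cubicResidueSymbol_zero hζ]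
    rw [this, mul_zero] at h
    exact zero_ne_one h
  have hq3' : Nat.Coprime q 3 := by
    rw [Nat.coprime_comm, Nat.Prime.coprime_iff_not_dvd (by norm_num)]
    omega
  have hy3 : y ^ 3 = 1 := (cubicResidueSymbol_spec hζ (three_not_mem_of_natCast_mem hq𝔮 hq3') hy0).1
  calc x = x * (y * y ^ 2) := by rw [← pow_succ', hy3, mul_one]
    _ = x * y * y ^ 2 := by ring
    _ = y ^ 2 := by rw [h, one_mul]

end Reciprocity

end Literature.NumberTheory.GaloisRepresentations

end
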